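import Literature.Topology.Immersions.ProjectionFieldBundle
import Mathlib.LinearAlgebra.Orientation
import Mathlib.Analysis.Normed.Module.FiniteDimension
import HarnessLib

/-!
# Orientations of projection-field bundles

Topic `Literature/Topology/Immersions`. An **orientation** of a rank-`k` bundle `E = E(P)` in
`M × ℝᵐ` (`ProjectionFieldBundle.lean`) is a choice of orientation of every fibre `E_x` which
is locally constant in the bundle charts (Milnor–Stasheff, *Characteristic Classes* (1974), §9
p. 96: "an orientation of `E` is a function assigning an orientation to each fibre … subject to
the local compatibility condition" that near every point there are local sections
`s₁, …, s_k` forming a positively oriented basis of every nearby fibre). We encode a fibre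
orientation as Mathlib's `Orientation ℝ (E_x) (Fin k)` of the submodule `E_x ⊆ ℝᵐ`, frames of
a fibre as injective linear maps `A : ℝᵏ →L ℝᵐ` with range `E_x`, and local compatibility by
comparison with the transported frames `A_x = P_x ∘ B_{x₀}` of the bundle charts (`frameAt`):

* `ProjBundle.basisOfFrame`, `ProjBundle.orientationOfFrame` — the basis / orientation of
  `E_x` defined by a frame; `repr_basisOfFrame` (coordinates are `leftInv A`);
* `ProjBundle.orientationOfFrame_eq_iff_det_pos` — **two frames define the same orientation iff
  the transition `c ↦ leftInv A (A' c)` has positive determinant**;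
* `ProjBundle.IsOrientation P o` — `o x` agrees or disagrees with the chart frame orientation
  locally constantly; `IsOrientation.neg`;
* `ProjBundle.isOrientation_of_localFrame` — **orientations given locally by continuous frames
  are orientations** (the Milnor–Stasheff formulation).

Everything here is proved; `IsOrientation` is a `Prop`-valued structure with explicit
parameters, no named facts are introduced.

## References

* J. Milnor, J. Stasheff, *Characteristic Classes* (1974), §9 p. 96 (orientations of vector
  bundles). [MilnorStasheff1974]
-/

open scoped Manifold ContDiff Topology
open Set Function Module Filter

noncomputable section

namespace Literature.Topology.Immersions

/-- Local notation: `𝔼 n` is the model Euclidean space `EuclideanSpace ℝ (Fin n)`. -/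
local notation "𝔼 " n:arg => EuclideanSpace ℝ (Fin n)

open Literature.Topology.FourManifolds (leftInv leftInv_apply_self apply_leftInv_of_mem_range
  leftInv_injOn contDiffAt_leftInv)

namespace ProjBundle

variable {n m k : ℕ} {M : Type*} [TopologicalSpace M] [ChartedSpace (𝔼 n) M]
  (P : ProjBundle n m k M)

/-! ### Frames of a fibre and the orientations they define -/

/-- **The basis of `E_x` defined by a frame** `A : ℝᵏ →L ℝᵐ` (injective, range `E_x`): the
images of the standard basis vectors. [folklore] -/
def basisOfFrame {x : M} (A : 𝔼 k →L[ℝ] 𝔼 m) (hA : Injective A)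
    (hr : LinearMap.range A.toLinearMap = P.fibre x) : Basis (Fin k) ℝ (P.fibre x) :=
  Basis.mk (v := fun j => (⟨A (EuclideanSpace.single j 1), hr ▸ LinearMap.mem_range_self _ _⟩ :
      P.fibre x))
    (by
      have hb := (EuclideanSpace.basisFun (Fin k) ℝ).toBasis.linearIndependent
      have h1 := hb.map' (A : 𝔼 k →ₗ[ℝ] 𝔼 m) (LinearMap.ker_eq_bot.2 hA)
      have h2 : LinearIndependent ℝ fun j => A (EuclideanSpace.single j 1) := by
        simpa [Function.comp_def] using h1
      exact LinearIndependent.of_comp (P.fibre x).subtype (by simpa [Function.comp_def] using h2))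
    (by
      rintro ⟨w, hw⟩ -
      have hw' : w ∈ LinearMap.range A.toLinearMap := by rw [hr]; exact hw
      obtain ⟨c, rfl⟩ := hw'
      have hc : c = ∑ j, c j • EuclideanSpace.single j (1 : ℝ) := by
        simpa using ((EuclideanSpace.basisFun (Fin k) ℝ).sum_repr c).symm
      have : (⟨(A : 𝔼 k →ₗ[ℝ] 𝔼 m) c, hw⟩ : P.fibre x) =
          ∑ j, c j • (⟨A (EuclideanSpace.single j 1), hr ▸ LinearMap.mem_range_self _ _⟩ :
            P.fibre x) := by
        apply Subtype.ext
        rw [Submodule.coe_sum]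
        simp only [ContinuousLinearMap.coe_coe, SetLike.val_smul]
        conv_lhs => rw [hc]
        simp [map_sum, map_smul]
      rw [this]
      exact Submodule.sum_mem _ fun j _ => Submodule.smul_mem _ _ (Submodule.subset_span ⟨j, rfl⟩))

/-- The basis vectors of `basisOfFrame` are the frame vectors. [folklore] -/
theorem basisOfFrame_apply {x : M} (A : 𝔼 k →L[ℝ] 𝔼 m) (hA : Injective A)
    (hr : LinearMap.range A.toLinearMap = P.fibre x) (j : Fin k) :
    (P.basisOfFrame A hA hr j : 𝔼 m) = A (EuclideanSpace.single j 1) := by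
  simp [basisOfFrame]

/-- **Coordinates in the frame basis are given by `leftInv A`.** [folklore] -/
theorem repr_basisOfFrame {x : M} (A : 𝔼 k →L[ℝ] 𝔼 m) (hA : Injective A)
    (hr : LinearMap.range A.toLinearMap = P.fibre x) (w : P.fibre x) (i : Fin k) :
    (P.basisOfFrame A hA hr).repr w i = leftInv A (w : 𝔼 m) i := by
  set b := P.basisOfFrame A hA hr
  have hw : (w : 𝔼 m) ∈ LinearMap.range A.toLinearMap := by rw [hr]; exact w.2
  -- `∑ (leftInv A w)_j • b_j = w`
  have hsum : b.equivFun.symm (fun j => leftInv A (w : 𝔼 m) j) = w := by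
    rw [Basis.equivFun_symm_apply]
    apply Subtype.ext
    rw [Submodule.coe_sum]
    simp only [SetLike.val_smul, b, basisOfFrame_apply]
    have h1 : ∑ j, leftInv A (w : 𝔼 m) j • A (EuclideanSpace.single j 1) =
        A (∑ j, leftInv A (w : 𝔼 m) j • EuclideanSpace.single j (1 : ℝ)) := by
      simp [map_sum, map_smul]
    rw [h1]
    have h2 : ∑ j, leftInv A (w : 𝔼 m) j • EuclideanSpace.single j (1 : ℝ) = leftInv A (w : 𝔼 m) := by
      simpa using (EuclideanSpace.basisFun (Fin k) ℝ).sum_repr (leftInv A (w : 𝔼 m))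
    rw [h2]
    exact apply_leftInv_of_mem_range hA hw
  have h := congrArg b.equivFun hsum
  rw [LinearEquiv.apply_symm_apply] at h
  rw [← Basis.equivFun_apply, ← h]

/-- **The orientation of `E_x` defined by a frame.** [cite: MilnorStasheff1974, §9 p. 96] -/
def orientationOfFrame {x : M} (A : 𝔼 k →L[ℝ] 𝔼 m) (hA : Injective A)
    (hr : LinearMap.range A.toLinearMap = P.fibre x) : Orientation ℝ (P.fibre x) (Fin k) :=
  (P.basisOfFrame A hA hr).orientation

/-- The **transition endomorphism** `c ↦ leftInv A (A' c)` of `ℝᵏ` between two frames.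
[folklore] -/
def frameTransition (A A' : 𝔼 k →L[ℝ] 𝔼 m) : 𝔼 k →L[ℝ] 𝔼 k := (leftInv A).comp A'

/-- The change-of-basis determinant between two frame bases is the determinant of the
transition endomorphism. [folklore] -/
theorem det_basisOfFrame {x : M} (A A' : 𝔼 k →L[ℝ] 𝔼 m) (hA : Injective A) (hA' : Injective A')
    (hr : LinearMap.range A.toLinearMap = P.fibre x)
    (hr' : LinearMap.range A'.toLinearMap = P.fibre x) :
    (P.basisOfFrame A hA hr).det (P.basisOfFrame A' hA' hr') =
      LinearMap.det (frameTransition A A' : 𝔼 k →ₗ[ℝ] 𝔼 k) := by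
  classical
  rw [Basis.det_apply, ← LinearMap.det_toMatrix (EuclideanSpace.basisFun (Fin k) ℝ).toBasis]
  congr 1
  ext i j
  rw [Basis.toMatrix_apply, repr_basisOfFrame, LinearMap.toMatrix_apply, basisOfFrame_apply]
  simp [frameTransition]

/-- **Two frames define the same orientation iff their transition has positive determinant.**
[cite: MilnorStasheff1974, §9 p. 96] -/
theorem orientationOfFrame_eq_iff_det_pos {x : M} (A A' : 𝔼 k →L[ℝ] 𝔼 m) (hA : Injective A)
    (hA' : Injective A') (hr : LinearMap.range A.toLinearMap = P.fibre x)
    (hr' : LinearMap.range A'.toLinearMap = P.fibre x) :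
    P.orientationOfFrame A hA hr = P.orientationOfFrame A' hA' hr' ↔
      0 < LinearMap.det (frameTransition A A' : 𝔼 k →ₗ[ℝ] 𝔼 k) := by
  rw [orientationOfFrame, orientationOfFrame, Basis.orientation_eq_iff_det_pos, det_basisOfFrame]

/-- The change-of-frame determinant between two frames of the same fibre is nonzero.
[folklore] -/
theorem det_frameTransition_ne_zero {x : M} (A A' : 𝔼 k →L[ℝ] 𝔼 m) (hA : Injective A)
    (hA' : Injective A') (hr : LinearMap.range A.toLinearMap = P.fibre x)
    (hr' : LinearMap.range A'.toLinearMap = P.fibre x) :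
    LinearMap.det (frameTransition A A' : 𝔼 k →ₗ[ℝ] 𝔼 k) ≠ 0 := by
  rw [← P.det_basisOfFrame A A' hA hA' hr hr']
  exact ((P.basisOfFrame A hA hr).isUnit_det (P.basisOfFrame A' hA' hr')).ne_zero

/-! ### Orientations of the bundle -/

/-- The orientation of `E_x` given by the bundle chart at `x₀` (the transported frame
`A_x = P_x ∘ B_{x₀}`), for `x` in the good set of `x₀`. [folklore] -/
def chartOrientation {x₀ x : M} (hx : x ∈ P.goodSet x₀) : Orientation ℝ (P.fibre x) (Fin k) :=
  P.orientationOfFrame (P.frameAt x₀ x) hx.2 (P.range_frameAt_of_mem hx)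

/-- **An orientation of the bundle `E(P)`**: an orientation of every fibre which, near every
point `x₀`, agrees with the chart orientation at `x` exactly when it does so at `x₀` (local
constancy in the bundle charts). [cite: MilnorStasheff1974, §9 p. 96] -/
structure IsOrientation (o : ∀ x, Orientation ℝ (P.fibre x) (Fin k)) : Prop where
  eventually_iff : ∀ x₀ : M, ∀ᶠ x in 𝓝 x₀, ∀ hx : x ∈ P.goodSet x₀,
    (o x = P.chartOrientation hx ↔ o x₀ = P.chartOrientation (P.mem_goodSet_self x₀))

/-- In a fibre, `-a = c ↔ a ≠ c` for orientations. [folklore] -/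
theorem neg_eq_iff_ne {x : M} (a c : Orientation ℝ (P.fibre x) (Fin k)) : -a = c ↔ a ≠ c := by
  have hcard : Fintype.card (Fin k) = finrank ℝ (P.fibre x) := by
    rw [Fintype.card_fin]
    exact (P.finrank_range x).symm
  constructor
  · rintro h rfl
    exact Module.Ray.ne_neg_self a h.symm
  · intro h
    rcases a.eq_or_eq_neg c hcard with h' | h'
    · exact absurd h' h
    · rw [h']
      exact neg_neg c

variable {P} in
/-- **The opposite orientation.** [cite: MilnorStasheff1974, §9 p. 96] -/
theorem IsOrientation.neg {o : ∀ x, Orientation ℝ (P.fibre x) (Fin k)} (h : P.IsOrientation o) :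
    P.IsOrientation fun x => -o x := by
  refine ⟨fun x₀ => (h.eventually_iff x₀).mono fun x hx hxg => ?_⟩
  rw [P.neg_eq_iff_ne, P.neg_eq_iff_ne, not_iff_not]
  exact hx hxg

/-- **Orientations given locally by continuous frames are orientations** (Milnor–Stasheff's
formulation: near every point there are continuous local sections forming a positively
oriented basis of every nearby fibre). [cite: MilnorStasheff1974, §9 p. 96] -/
theorem isOrientation_of_localFrame (o : ∀ x, Orientation ℝ (P.fibre x) (Fin k))
    (h : ∀ x₀ : M, ∃ U ∈ 𝓝 x₀, ∃ c : M → (𝔼 k →L[ℝ] 𝔼 m), ContinuousOn c U ∧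
      ∀ x ∈ U, ∃ (hi : Injective (c x)) (hr : LinearMap.range (c x).toLinearMap = P.fibre x),
        o x = P.orientationOfFrame (c x) hi hr) :
    P.IsOrientation o := by
  refine ⟨fun x₀ => ?_⟩
  obtain ⟨U, hU, c, hc, hco⟩ := h x₀
  -- the transition determinant `d x = det (leftInv (A_x) ∘ c_x)` is continuous and nonvanishing
  let g : M → (𝔼 k →L[ℝ] 𝔼 k) := fun x => frameTransition (P.frameAt x₀ x) (c x)
  have hS : U ∩ P.goodSet x₀ ∈ 𝓝 x₀ :=
    inter_mem hU ((P.isOpen_goodSet x₀).mem_nhds (P.mem_goodSet_self x₀))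
  have hg : ContinuousOn g (U ∩ P.goodSet x₀) := by
    have h1 : ContinuousOn (fun x => leftInv (P.frameAt x₀ x)) (U ∩ P.goodSet x₀) := fun x hx =>
      ((contDiffAt_leftInv hx.2.2).continuousAt.comp_continuousWithinAt
        (P.continuous_frameAt x₀).continuousWithinAt)
    exact h1.clm_comp (hc.mono inter_subset_left)
  have hd : ContinuousOn (fun x => (g x).det) (U ∩ P.goodSet x₀) :=
    ContinuousLinearMap.continuous_det.comp_continuousOn hg
  have hiff : ∀ x (hx : x ∈ U ∩ P.goodSet x₀), (o x = P.chartOrientation hx.2) ↔ 0 < (g x).det := by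
    intro x hx
    obtain ⟨hi, hr, hox⟩ := hco x hx.1
    rw [hox, eq_comm, chartOrientation, orientationOfFrame_eq_iff_det_pos]
  have hne : ∀ x (hx : x ∈ U ∩ P.goodSet x₀), (g x).det ≠ 0 := by
    intro x hx
    obtain ⟨hi, hr, -⟩ := hco x hx.1
    exact P.det_frameTransition_ne_zero _ _ hx.2.2 hi (P.range_frameAt_of_mem hx.2) hr
  -- local constancy of the sign of `d` at `x₀`
  have hx₀S : x₀ ∈ U ∩ P.goodSet x₀ := ⟨mem_of_mem_nhds hU, P.mem_goodSet_self x₀⟩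
  have hda : ContinuousAt (fun x => (g x).det) x₀ := (hd x₀ hx₀S).continuousAt hS
  have hsign : ∀ᶠ x in 𝓝 x₀, (0 < (g x).det ↔ 0 < (g x₀).det) := by
    rcases lt_or_gt_of_ne (hne x₀ hx₀S) with hneg | hpos
    · filter_upwards [hda.eventually (gt_mem_nhds hneg)] with x hx
      exact ⟨fun h' => absurd hx (not_lt.2 h'.le), fun h' => absurd hneg (not_lt.2 h'.le)⟩
    · filter_upwards [hda.eventually (lt_mem_nhds hpos)] with x hx
      exact ⟨fun _ => hpos, fun _ => hx⟩
  filter_upwards [hsign, hS] with x hx hxS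
  intro hxg
  rw [hiff x hxS, hiff x₀ hx₀S]
  exact hx

end ProjBundle

end Literature.Topology.Immersions
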